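import Summits.AtomisticToContinuum.Crystallization.Theorems.FrustratedLawDichotomyStrainedPatchHomEntryTableKH
import Summits.AtomisticToContinuum.Crystallization.Theorems.FrustratedLawDichotomyStrainedPatchHomLeafTableSoundP

/-!
# The PARAM-FORM table verdict `tableLeafOKP` (checker v4, "P") and `(H) HomFloor` from two search Booleans with it (certificate v7)

decomp-a2c hand-1 g23 (crux `AperiodicFrustratedLawGap`, stmt-AtomisticToContinuum-27623; critic row 882).  The census (2026-09-01 16:11Z) found
every fcc leaf disjunct capped at entry half-width `≤ 2⁻⁸` regardless of margin (`⇒ ≈ 3·10⁹` leaves).  Float model + farm pilot (HOME/decomp-a2c-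
hand-1/g23): the PARAM-FORM table leaf `…HomLeafTableCheckP.leafCheckP` — label functional pulled back to the ENTRY box (`L′ = P_a n_b / SC`, exact
integers), remainder classes `ρ`, gradient penalty pulled back through `H = MgM` — accepts exactly TWO dyadic steps wider boxes than the tiered Gram-class
leaf at 17/17 centres on the SAME tier tables (identity `2⁻⁹ → 2⁻⁷`, strains `2⁻⁸ → 2⁻⁶`, critical layer `2⁻¹⁰ → 2⁻⁸`).

* §1 the `n`-class sums of the tree's label list (`sumNZ`, kernel certificate, `nearLabels_AN`);
* §2 ★ `leafCheckP_sound_fcc` (far labels from `‖U − 1‖ ≤ 1/4`: cover of norm `≤ 35`, sorted list, stop `≥ 36`) and ★★ `boxSum_ge_of_leafCheckP` — the fcc box-sum floor from ONE `leafCheckP` against ANY tier, for every `U` with `‖U − 1‖ ≤ 1/4` whose ENTRIES lie in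
  the box (`…HomLeafTableSoundP.leafCheckP_sound_fcc` + the tree's list facts);
* §3 ★ `tableLeafOKP μ c w := cenOKP c ∧ tierTables.any (leafCheckP · …)` with `tableLeafOKP_sound` in the `hver` shape of `…HomEntryGram.fccHalf_of_entryTree`;
* §4 the verdict chain of record with the param leaf PREPENDED — `entryLeafOKBKP := tableLeafOKP ∨ entryLeafOKBK`, `entryLeafOKDBKP`, `entryLeafOKDBsKP`,
  ★ `entryLeafOK6RBKP` — each with its soundness lemma (verbatim shapes of `…HomEntryTableK`), `fccHalf_of_entrySearch6RBKP`, and ★★★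
  `homFloor_of_entrySearches6RBKP3RDTK` / `homFloor_625_…` / `homFloor_milli_…` (= TARGET CERTIFICATE v7: v6 with `entryLeafOK6RBKP` on the fcc side);
* §5 kernel smoke test: the identity entry box of half-width `2⁻⁸` is ACCEPTED by `tableLeafOKP` and REJECTED by the tiered Gram-class verdict `tableLeafOKK`.

Computable definitions; 0 sorry; standard axioms; no instances / notation / `#eval`.  `--supports stmt-AtomisticToContinuum-27623`.
-/

namespace Summit.AtomisticToContinuum.Crystallization.Theorems.FrustratedLawDichotomyStrainedPatchHomEntryTableP

open scoped BigOperators RealInnerProductSpace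
open Literature.Analysis.ValidatedNumerics.Numerics
open Summit.AtomisticToContinuum.Crystallization.Theorems.ChargedEnergyGapNegative (E3)
open Summit.AtomisticToContinuum.Crystallization.Theorems.FrustratedLawDichotomySchurCut (effPot w₄₅ ω₄)
open Summit.AtomisticToContinuum.Crystallization.Theorems.FrustratedLawDichotomyAveragingRuleTightFree (TightNearCap BadNearCap)
open Summit.AtomisticToContinuum.Crystallization.Theorems.FrustratedLawDichotomyExemptAbsorption (ExemptNear)
open Summit.AtomisticToContinuum.Crystallization.Theorems.FrustratedLawDichotomyStrainedPatchHomSplit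
open Summit.AtomisticToContinuum.Crystallization.Theorems.FrustratedLawDichotomyStrainedPatchHomPrunedPolar (homFloor_of_prunedBoxSums_selfAdjoint)
open Summit.AtomisticToContinuum.Crystallization.Theorems.FrustratedLawDichotomyStrainedPatchHomEntryGram
open Summit.AtomisticToContinuum.Crystallization.Theorems.FrustratedLawDichotomyStrainedPatchHomEntryGramHcp (rootCH rootWH)
open Summit.AtomisticToContinuum.Crystallization.Theorems.FrustratedLawDichotomyStrainedPatchHomEntryTable (muRec muRec_ok)
open Summit.AtomisticToContinuum.Crystallization.Theorems.FrustratedLawDichotomyStrainedPatchHomEntrySearch (searchOK exists_tree_of_searchOK)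
open Summit.AtomisticToContinuum.Crystallization.Theorems.FrustratedLawDichotomyStrainedPatchHomEntrySym (domOut false_of_domOut)
open Summit.AtomisticToContinuum.Crystallization.Theorems.FrustratedLawDichotomyStrainedPatchHomEntrySign (signOut false_of_signOut fccHalf_of_entryTreeDom)
open Summit.AtomisticToContinuum.Crystallization.Theorems.FrustratedLawDichotomyStrainedPatchHomEntrySix (symIdx hbox_sym muMilli muMilli_ok)
open Summit.AtomisticToContinuum.Crystallization.Theorems.FrustratedLawDichotomyStrainedPatchHomEntryRadial (radOK radOK_sound)
open Summit.AtomisticToContinuum.Crystallization.Theorems.FrustratedLawDichotomyStrainedPatchHomEntrySymBox (symU hbox_symU)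
open Summit.AtomisticToContinuum.Crystallization.Theorems.FrustratedLawDichotomyStrainedPatchHomEntryTableK (tierTables tierTables_allOKK entryLeafOKBK entryLeafOKBK_sound tableLeafOKK)
open Summit.AtomisticToContinuum.Crystallization.Theorems.FrustratedLawDichotomyStrainedPatchHomEntryTableHcp (entryLeafOKH3RDTK hcpHalf_of_entrySearchH3RDTK)
open Summit.AtomisticToContinuum.Crystallization.Theorems.FrustratedLawDichotomyStrainedPatchHomLeafTableCheck
open Literature.Barriers.AtomisticToContinuum.FlatleyTheil2015 (fccVec)

/-! ## §1. The `n`-class sums of the label list -/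

/-- The six `n`-class sums `(Σ|n₀n₀|, Σ|n₁n₁|, Σ|n₂n₂|, Σ|n₀n₁|, Σ|n₀n₂|, Σ|n₁n₂|)` of a label list (`n_c = Σ_{j≠c} b_j`). -/
def sumNZ : List NL → ℕ × ℕ × ℕ × ℕ × ℕ × ℕ
  | [] => (0, 0, 0, 0, 0, 0)
  | l :: ls =>
    match sumNZ ls with
    | (a0, a1, a2, a3, a4, a5) =>
      ((Int.mul (n0 l) (n0 l)).natAbs + a0, (Int.mul (n1 l) (n1 l)).natAbs + a1, (Int.mul (n2 l) (n2 l)).natAbs + a2,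
        (Int.mul (n0 l) (n1 l)).natAbs + a3, (Int.mul (n0 l) (n2 l)).natAbs + a4, (Int.mul (n1 l) (n2 l)).natAbs + a5)

/-- The `n`-class sums of the tree's near-label list are `(8900, 8900, 8900, 5678, 5678, 5678)`. [kernel computation] -/
theorem nearLabels_sumNZ : sumNZ nearLabels = (tabANd, tabANd, tabANd, tabANo, tabANo, tabANo) := by decide +kernel

/-- `sumNZ` ARE the six list sums of `|n_c n_b|`. [formal bookkeeping] -/
theorem sumNZ_eq : ∀ (ls : List NL), sumNZ ls =
    ((ls.map (fun l => (nZ l 0 * nZ l 0).natAbs)).sum, (ls.map (fun l => (nZ l 1 * nZ l 1).natAbs)).sum, (ls.map (fun l => (nZ l 2 * nZ l 2).natAbs)).sum,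
      (ls.map (fun l => (nZ l 0 * nZ l 1).natAbs)).sum, (ls.map (fun l => (nZ l 0 * nZ l 2).natAbs)).sum, (ls.map (fun l => (nZ l 1 * nZ l 2).natAbs)).sum)
  | [] => rfl
  | l :: ls => by
    rw [sumNZ, sumNZ_eq ls]
    simp [nZ, Int.mul_def]

/-- ★ The `n`-class hypothesis of `leafCheckP_sound` for the tree's list with the constants `tabANd` / `tabANo`. [formal bookkeeping] -/
theorem nearLabels_AN (cc bb : Fin 3) : (nearLabels.map (fun l => (nZ l cc * nZ l bb).natAbs)).sum ≤ ANt tabANd tabANo cc bb := by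
  have h := nearLabels_sumNZ
  rw [sumNZ_eq] at h
  simp only [Prod.mk.injEq] at h
  obtain ⟨h0, h1, h2, h3, h4, h5⟩ := h
  have hsym : ∀ c b : Fin 3, (nearLabels.map (fun l => (nZ l c * nZ l b).natAbs)).sum = (nearLabels.map (fun l => (nZ l b * nZ l c).natAbs)).sum :=
    fun c b => by simp only [mul_comm]
  fin_cases cc <;> fin_cases bb <;> simp only [ANt, Fin.isValue, Fin.zero_eta, Fin.mk_one, Fin.reduceFinMk] <;>
    first | (rw [h0]; rfl) | (rw [h1]; rfl) | (rw [h2]; rfl) | (rw [h3]; decide) | (rw [h4]; decide) | (rw [h5]; decide) |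
      (rw [hsym, h3]; decide) | (rw [hsym, h4]; decide) | (rw [hsym, h5]; decide)

/-! ## §2. The fcc corollary of `leafCheckP_sound` and the box-sum floor against any tier -/

/-- ★ **SOUNDNESS OF THE PARAM-FORM LEAF CHECK, far labels from `‖U − 1‖ ≤ 1/4`** (cover of norm `≤ 35`, sorted list, stop `≥ 36`; shape of
`leafCheck_sound_fccK` with the Gram box replaced by the ENTRY box). [folklore] -/
theorem leafCheckP_sound_fcc {tab : QT} {P : ℕ} {labs : List NL} {E A0 A1 A2 A3 A4 A5 ANd ANo nstop : ℕ} {c w : Fin 3 × Fin 3 → ℤ}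
    {sμ : Bool} {aμ : ℕ}
    (htab : tab.allOK E = true ∨ tab.allOKK E P = true) (hok : ∀ l ∈ labs, l.ok = true)
    (hbox7 : ∀ l ∈ labs, l.toLab ∈ (Fintype.piFinset fun _ : Fin 3 => Finset.Icc (-7 : ℤ) 7).filter (fun b => b ≠ 0))
    (hcanon : ∀ l ∈ labs, ∀ l' ∈ labs, l.toLab ≠ -l'.toLab) (hnd : (labs.map NL.toLab).Nodup)
    (hA : (labs.map NL.m00).sum ≤ A0 ∧ (labs.map NL.m11).sum ≤ A1 ∧ (labs.map NL.m22).sum ≤ A2 ∧ (labs.map NL.m01).sum ≤ A3 ∧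
      (labs.map NL.m02).sum ≤ A4 ∧ (labs.map NL.m12).sum ≤ A5)
    (hAN : ∀ cc bb : Fin 3, (labs.map (fun l => (nZ l cc * nZ l bb).natAbs)).sum ≤ ANt ANd ANo cc bb)
    (hcovN : ∀ b ∈ (Fintype.piFinset fun _ : Fin 3 => Finset.Icc (-7 : ℤ) 7).filter (fun b => b ≠ 0), nbZ b ≤ 35 →
      ∃ l ∈ labs, l.toLab = b ∨ l.toLab = -b)
    (hsorted : labs.Pairwise (fun x y => x.n ≤ y.n)) (hn : 36 ≤ nstop) (hcen : cenOKP c = true)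
    (h : leafCheckP tab labs E A0 A1 A2 A3 A4 A5 ANd ANo nstop (gbP c w).toLK (epOf c w) sμ aμ = true) (U : E3 →L[ℝ] E3) (hU : ‖U - 1‖ ≤ 1 / 4)
    (hbox : ∀ ab : Fin 3 × Fin 3, |(U (EuclideanSpace.single ab.2 (1 : ℝ))) ab.1 - (c ab : ℝ) / SC| ≤ (w ab : ℝ) / SC) :
    ((sgnZ sμ aμ : ℤ) : ℝ) / SC ≤
      ∑ b ∈ (Fintype.piFinset fun _ : Fin 3 => Finset.Icc (-7 : ℤ) 7).filter (fun b => b ≠ 0), effPot w₄₅ ω₄ (3 / 400) ‖latPt U fccVec b‖ := by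
  refine leafCheckP_sound htab hok hbox7 hcanon hnd hA hAN hcen h U hbox (fun b hb => ?_) (fun l hl hv => ?_)
  · by_cases h35 : nbZ b ≤ 35
    · exact Or.inl (hcovN b hb h35)
    · exact Or.inr (far_of_nb hU (by omega))
  · have hge := le_of_not_mem_visited nstop labs hsorted l hl hv
    refine far_of_nb hU ?_
    rw [← NL.n_eq (hok l hl)]
    exact_mod_cast hn.trans hge

/-- ★★ **THE PARAM-FORM fcc CERTIFICATE against ANY TIER**: one evaluation `leafCheckP tab nearLabels tabE tabA0 … tabA5 tabANd tabANo 36 (gbP c w).toLK (epOf c w)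
sμ aμ = true` (with `cenOKP c`) bounds the fcc box sum of every `U` with `‖U − 1‖ ≤ 1/4` whose ENTRIES lie in the box `(c, w)`. [folklore] -/
theorem boxSum_ge_of_leafCheckP {tab : QT} (htab : tab ∈ tierTables) {c w : Fin 3 × Fin 3 → ℤ} {sμ : Bool} {aμ : ℕ} (hcen : cenOKP c = true)
    (h : leafCheckP tab nearLabels tabE tabA0 tabA1 tabA2 tabA3 tabA4 tabA5 tabANd tabANo 36 (gbP c w).toLK (epOf c w) sμ aμ = true)
    (U : E3 →L[ℝ] E3) (hU : ‖U - 1‖ ≤ 1 / 4)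
    (hbox : ∀ ab : Fin 3 × Fin 3, |(U (EuclideanSpace.single ab.2 (1 : ℝ))) ab.1 - (c ab : ℝ) / SC| ≤ (w ab : ℝ) / SC) :
    ((sgnZ sμ aμ : ℤ) : ℝ) / SC ≤
      ∑ b ∈ (Fintype.piFinset fun _ : Fin 3 => Finset.Icc (-7 : ℤ) 7).filter (fun b => b ≠ 0), effPot w₄₅ ω₄ (3 / 400) ‖latPt U fccVec b‖ :=
  leafCheckP_sound_fcc (P := 7) (Or.inr (tierTables_allOKK tab htab)) (ok_of_allNLok nearLabels_ok) (box_of_allInBox nearLabels_inBox)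
    (canon_hyp_of_allCanon nearLabels_canon) (nodup_sorted_of_chainLt nearLabels_ok nearLabels_chain).1 (classSums_of_sumM nearLabels_sumM)
    nearLabels_AN (cover_of_coverCheck nearLabels_cover) (nodup_sorted_of_chainLt nearLabels_ok nearLabels_chain).2 le_rfl hcen h U hU hbox

/-! ## §3. The param-form table verdict -/

/-- ★ **THE PARAM-FORM TABLE VERDICT on an entry box**: guard ∧ the param-form leaf checker against the tier tables in turn (stop norm `36`). -/
def tableLeafOKP (μ : ℤ) (c w : Fin 3 × Fin 3 → ℤ) : Bool :=
  cenOKP c && tierTables.any fun tab =>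
    leafCheckP tab nearLabels tabE tabA0 tabA1 tabA2 tabA3 tabA4 tabA5 tabANd tabANo 36 (gbP c w).toLK (epOf c w) (decide (μ < 0)) μ.natAbs

/-- ★★ **SOUNDNESS OF THE PARAM-FORM TABLE VERDICT** (the `hver` shape of `…HomEntryGram.fccHalf_of_entryTree`): for every `U` with `‖U − 1‖ ≤ 1/4`
whose entries lie in the box, `μ/SC ≤ Σ_{b ∈ [−7,7]³∖0} W₄₅ ‖latPt U fccVec b‖`. [folklore] -/
theorem tableLeafOKP_sound {μ : ℤ} {c w : Fin 3 × Fin 3 → ℤ} (h : tableLeafOKP μ c w = true) (U : E3 →L[ℝ] E3)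
    (_hsa : ∀ v v' : E3, ⟪U v, v'⟫ = ⟪v, U v'⟫) (hU : ‖U - 1‖ ≤ 1 / 4)
    (hbox : ∀ ab : Fin 3 × Fin 3, |(U (EuclideanSpace.single ab.2 (1 : ℝ))) ab.1 - (c ab : ℝ) / SC| ≤ (w ab : ℝ) / SC) :
    (∀ (M : ℕ) (z : Fin M → E3) (c : Fin M), Function.Injective z →
        Set.range z = {x : E3 | dist x (z c) ≤ 133 / 10 ∧ ∃ a : Fin 3 → ℤ, x = z c + latPt U fccVec a} →
        TightNearCap (9 / 5) (3 / 2) z c ∨ ExemptNear (9 / 5) ExRec z c ∨ BadNearCap (9 / 5) (3 / 2) z c) ∨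
      (μ : ℝ) / SC ≤ ∑ b ∈ (Fintype.piFinset fun _ : Fin 3 => Finset.Icc (-7 : ℤ) 7).filter (fun b => b ≠ 0),
        effPot w₄₅ ω₄ (3 / 400) ‖latPt U fccVec b‖ := by
  simp only [tableLeafOKP, Bool.and_eq_true, List.any_eq_true] at h
  obtain ⟨hcen, tab, htab, hleaf⟩ := h
  refine Or.inr ?_
  have key := boxSum_ge_of_leafCheckP htab hcen hleaf U hU hbox
  rwa [Summit.AtomisticToContinuum.Crystallization.Theorems.FrustratedLawDichotomyStrainedPatchHomEntryTable.sgnZ_natAbs] at key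

/-! ## §4. The verdict chain of record with the param leaf prepended -/

/-- ★ **fcc ENTRY-LEAF VERDICT, param table ∨ record ∨ tiers**: `tableLeafOKP μ` FIRST (widest boxes), then `entryLeafOKBK μ`. -/
def entryLeafOKBKP (μ : ℤ) (c w : Fin 3 × Fin 3 → ℤ) : Bool := tableLeafOKP μ c w || entryLeafOKBK μ c w

/-- ★ Soundness of `entryLeafOKBKP` (shape of `…HomEntryGram.fccHalf_of_entryTree`). [folklore] -/
theorem entryLeafOKBKP_sound {μ : ℤ} {c w : Fin 3 × Fin 3 → ℤ} (h : entryLeafOKBKP μ c w = true) (U : E3 →L[ℝ] E3)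
    (hsa : ∀ v v' : E3, ⟪U v, v'⟫ = ⟪v, U v'⟫) (hU : ‖U - 1‖ ≤ 1 / 4)
    (hbox : ∀ ab : Fin 3 × Fin 3, |(U (EuclideanSpace.single ab.2 (1 : ℝ))) ab.1 - (c ab : ℝ) / SC| ≤ (w ab : ℝ) / SC) :
    (∀ (M : ℕ) (z : Fin M → E3) (c : Fin M), Function.Injective z →
        Set.range z = {x : E3 | dist x (z c) ≤ 133 / 10 ∧ ∃ a : Fin 3 → ℤ, x = z c + latPt U fccVec a} →
        TightNearCap (9 / 5) (3 / 2) z c ∨ ExemptNear (9 / 5) ExRec z c ∨ BadNearCap (9 / 5) (3 / 2) z c) ∨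
      (μ : ℝ) / SC ≤ ∑ b ∈ (Fintype.piFinset fun _ : Fin 3 => Finset.Icc (-7 : ℤ) 7).filter (fun b => b ≠ 0),
        effPot w₄₅ ω₄ (3 / 400) ‖latPt U fccVec b‖ := by
  simp only [entryLeafOKBKP, Bool.or_eq_true] at h
  rcases h with h | h
  · exact tableLeafOKP_sound h U hsa hU hbox
  · exact entryLeafOKBK_sound h U hsa hU hbox

/-- ★ **… OVER THE FUNDAMENTAL DOMAIN**: sign prune ∨ sorted-diagonal prune ∨ `entryLeafOKBKP μ`. -/
def entryLeafOKDBKP (μ : ℤ) (c w : Fin 3 × Fin 3 → ℤ) : Bool := signOut c w || domOut c w || entryLeafOKBKP μ c w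

/-- ★ Soundness of `entryLeafOKDBKP` RELATIVE to the fundamental domain (shape of `…HomEntrySign.fccHalf_of_entryTreeDom`). [folklore] -/
theorem entryLeafOKDBKP_sound {μ : ℤ} {c w : Fin 3 × Fin 3 → ℤ} (h : entryLeafOKDBKP μ c w = true) (U : E3 →L[ℝ] E3)
    (hsa : ∀ v v' : E3, ⟪U v, v'⟫ = ⟪v, U v'⟫) (hU : ‖U - 1‖ ≤ 1 / 4)
    (hbox : ∀ ab : Fin 3 × Fin 3, |(U (EuclideanSpace.single ab.2 (1 : ℝ))) ab.1 - (c ab : ℝ) / SC| ≤ (w ab : ℝ) / SC)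
    (h1 : (U (EuclideanSpace.single 1 (1 : ℝ))) 1 ≤ (U (EuclideanSpace.single 0 (1 : ℝ))) 0)
    (h2 : (U (EuclideanSpace.single 2 (1 : ℝ))) 2 ≤ (U (EuclideanSpace.single 1 (1 : ℝ))) 1)
    (h01 : 0 ≤ (U (EuclideanSpace.single 1 (1 : ℝ))) 0) (h02 : 0 ≤ (U (EuclideanSpace.single 2 (1 : ℝ))) 0) :
    (∀ (M : ℕ) (z : Fin M → E3) (c : Fin M), Function.Injective z →
        Set.range z = {x : E3 | dist x (z c) ≤ 133 / 10 ∧ ∃ a : Fin 3 → ℤ, x = z c + latPt U fccVec a} →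
        TightNearCap (9 / 5) (3 / 2) z c ∨ ExemptNear (9 / 5) ExRec z c ∨ BadNearCap (9 / 5) (3 / 2) z c) ∨
      (μ : ℝ) / SC ≤ ∑ b ∈ (Fintype.piFinset fun _ : Fin 3 => Finset.Icc (-7 : ℤ) 7).filter (fun b => b ≠ 0),
        effPot w₄₅ ω₄ (3 / 400) ‖latPt U fccVec b‖ := by
  simp only [entryLeafOKDBKP, Bool.or_eq_true] at h
  rcases h with (h | h) | h
  · exact (false_of_signOut h (u := fun ab : Fin 3 × Fin 3 => (U (EuclideanSpace.single ab.2 (1 : ℝ))) ab.1) hbox h01 h02).elim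
  · exact (false_of_domOut h (u := fun ab : Fin 3 × Fin 3 => (U (EuclideanSpace.single ab.2 (1 : ℝ))) ab.1) hbox h1 h2).elim
  · exact entryLeafOKBKP_sound h U hsa hU hbox

/-- ★ **… THROUGH THE SYMMETRISED BOX**. -/
def entryLeafOKDBsKP (μ : ℤ) (c w : Fin 3 × Fin 3 → ℤ) : Bool := entryLeafOKDBKP μ (symU c) (symU w)

/-- ★ Soundness of `entryLeafOKDBsKP` RELATIVE to the fundamental domain. [folklore] -/
theorem entryLeafOKDBsKP_sound {μ : ℤ} {c w : Fin 3 × Fin 3 → ℤ} (h : entryLeafOKDBsKP μ c w = true) (U : E3 →L[ℝ] E3)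
    (hsa : ∀ v v' : E3, ⟪U v, v'⟫ = ⟪v, U v'⟫) (hU : ‖U - 1‖ ≤ 1 / 4)
    (hbox : ∀ ab : Fin 3 × Fin 3, |(U (EuclideanSpace.single ab.2 (1 : ℝ))) ab.1 - (c ab : ℝ) / SC| ≤ (w ab : ℝ) / SC)
    (h1 : (U (EuclideanSpace.single 1 (1 : ℝ))) 1 ≤ (U (EuclideanSpace.single 0 (1 : ℝ))) 0)
    (h2 : (U (EuclideanSpace.single 2 (1 : ℝ))) 2 ≤ (U (EuclideanSpace.single 1 (1 : ℝ))) 1)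
    (h01 : 0 ≤ (U (EuclideanSpace.single 1 (1 : ℝ))) 0) (h02 : 0 ≤ (U (EuclideanSpace.single 2 (1 : ℝ))) 0) :
    (∀ (M : ℕ) (z : Fin M → E3) (c : Fin M), Function.Injective z →
        Set.range z = {x : E3 | dist x (z c) ≤ 133 / 10 ∧ ∃ a : Fin 3 → ℤ, x = z c + latPt U fccVec a} →
        TightNearCap (9 / 5) (3 / 2) z c ∨ ExemptNear (9 / 5) ExRec z c ∨ BadNearCap (9 / 5) (3 / 2) z c) ∨
      (μ : ℝ) / SC ≤ ∑ b ∈ (Fintype.piFinset fun _ : Fin 3 => Finset.Icc (-7 : ℤ) 7).filter (fun b => b ≠ 0),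
        effPot w₄₅ ω₄ (3 / 400) ‖latPt U fccVec b‖ :=
  entryLeafOKDBKP_sound h U hsa hU (hbox_symU hsa hbox) h1 h2 h01 h02

/-- ★ **SIX-COORDINATE fcc VERDICT WITH THE PARAM LEAF, EVERY PRUNE IN THE TREE AND THE TIERS**: radial-bad prune (mirror) ∨ `entryLeafOKDBsKP μ`. -/
def entryLeafOK6RBKP (μ : ℤ) (c w : Fin 3 × Fin 3 → ℤ) : Bool := radOK (c ∘ symIdx) (w ∘ symIdx) || entryLeafOKDBsKP μ c w

/-- ★ Soundness of `entryLeafOK6RBKP` in the domain-relativised `hver` shape of `…HomEntrySign.fccHalf_of_entryTreeDom`. [folklore] -/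
theorem entryLeafOK6RBKP_sound {μ : ℤ} {c w : Fin 3 × Fin 3 → ℤ} (h : entryLeafOK6RBKP μ c w = true) (U : E3 →L[ℝ] E3)
    (hsa : ∀ v v' : E3, ⟪U v, v'⟫ = ⟪v, U v'⟫) (hU : ‖U - 1‖ ≤ 1 / 4)
    (hbox : ∀ ab : Fin 3 × Fin 3, |(U (EuclideanSpace.single ab.2 (1 : ℝ))) ab.1 - (c ab : ℝ) / SC| ≤ (w ab : ℝ) / SC)
    (h1 : (U (EuclideanSpace.single 1 (1 : ℝ))) 1 ≤ (U (EuclideanSpace.single 0 (1 : ℝ))) 0)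
    (h2 : (U (EuclideanSpace.single 2 (1 : ℝ))) 2 ≤ (U (EuclideanSpace.single 1 (1 : ℝ))) 1)
    (h01 : 0 ≤ (U (EuclideanSpace.single 1 (1 : ℝ))) 0) (h02 : 0 ≤ (U (EuclideanSpace.single 2 (1 : ℝ))) 0) :
    (∀ (M : ℕ) (z : Fin M → E3) (c : Fin M), Function.Injective z →
        Set.range z = {x : E3 | dist x (z c) ≤ 133 / 10 ∧ ∃ a : Fin 3 → ℤ, x = z c + latPt U fccVec a} →
        TightNearCap (9 / 5) (3 / 2) z c ∨ ExemptNear (9 / 5) ExRec z c ∨ BadNearCap (9 / 5) (3 / 2) z c) ∨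
      (μ : ℝ) / SC ≤ ∑ b ∈ (Fintype.piFinset fun _ : Fin 3 => Finset.Icc (-7 : ℤ) 7).filter (fun b => b ≠ 0),
        effPot w₄₅ ω₄ (3 / 400) ‖latPt U fccVec b‖ := by
  simp only [entryLeafOK6RBKP, Bool.or_eq_true] at h
  rcases h with h | h
  · exact Or.inl (radOK_sound h U hU (hbox_sym hsa hbox))
  · exact entryLeafOKDBsKP_sound h U hsa hU hbox h1 h2 h01 h02

/-- ★★ The fcc half from ONE six-coordinate search with the param-form verdict chain (any selector). [folklore] -/
theorem fccHalf_of_entrySearch6RBKP {m : ℝ} {μ : ℤ} (hμ : 2 * (m + (-(7175 / 10000) + 3 / 400)) * SC ≤ μ)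
    {sel : ℕ → (Fin 3 × Fin 3 → ℤ) → (Fin 3 × Fin 3 → ℤ) → Fin 3 × Fin 3} {fuel d : ℕ}
    (h : searchOK (entryLeafOK6RBKP μ) sel fuel d rootC rootW = true) :
    ∀ U : E3 →L[ℝ] E3, (∀ v w : E3, inner ℝ (U v) w = inner ℝ v (U w)) → (∀ w : E3, 0 ≤ inner ℝ w (U w)) → ‖U - 1‖ ≤ 1 / 4 →
      (∀ (M : ℕ) (z : Fin M → E3) (c : Fin M), Function.Injective z →
          Set.range z = {x : E3 | dist x (z c) ≤ 133 / 10 ∧ ∃ a : Fin 3 → ℤ, x = z c + latPt U fccVec a} →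
          TightNearCap (9 / 5) (3 / 2) z c ∨ ExemptNear (9 / 5) ExRec z c ∨ BadNearCap (9 / 5) (3 / 2) z c) ∨
      m ≤ (∑ b ∈ (Fintype.piFinset fun _ : Fin 3 => Finset.Icc (-7 : ℤ) 7).filter (fun b => b ≠ 0),
        effPot w₄₅ ω₄ (3 / 400) ‖latPt U fccVec b‖) / 2 - (-(7175 / 10000) + 3 / 400) := by
  obtain ⟨t, ht⟩ := exists_tree_of_searchOK (entryLeafOK6RBKP μ) sel fuel d rootC rootW h
  exact fccHalf_of_entryTreeDom hμ (entryLeafOK6RBKP μ)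
    (fun _ _ hv U hsa hU hbox h1 h2 h01 h02 => entryLeafOK6RBKP_sound hv U hsa hU hbox h1 h2 h01 h02) ht

/-- ★★★ **`(H) HomFloor m` FROM TWO SEARCH BOOLEANS, param-form leaf on the fcc side** (fcc `entryLeafOK6RBKP μ`, hcp `entryLeafOKH3RDTK μ` of certificate v6;
every `m`, `μ` with `2 (m + e_W) SC ≤ μ`; any selectors, fuel, depth). [folklore] -/
theorem homFloor_of_entrySearches6RBKP3RDTK {m : ℝ} {μ : ℤ} (hμ : 2 * (m + (-(7175 / 10000) + 3 / 400)) * SC ≤ μ)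
    {selF : ℕ → (Fin 3 × Fin 3 → ℤ) → (Fin 3 × Fin 3 → ℤ) → Fin 3 × Fin 3} {fuelF dF : ℕ}
    (hF : searchOK (entryLeafOK6RBKP μ) selF fuelF dF rootC rootW = true)
    {selH : ℕ → ((Fin 3 × Fin 3) ⊕ Fin 3 → ℤ) → ((Fin 3 × Fin 3) ⊕ Fin 3 → ℤ) → (Fin 3 × Fin 3) ⊕ Fin 3} {fuelH dH : ℕ}
    (hH : searchOK (entryLeafOKH3RDTK μ) selH fuelH dH rootCH rootWH = true) : HomFloor m :=
  homFloor_of_prunedBoxSums_selfAdjoint (fccHalf_of_entrySearch6RBKP hμ hF) (hcpHalf_of_entrySearchH3RDTK hμ hH)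

/-- ★★★ **`(H) HomFloor (1/625)`, TARGET CERTIFICATE v7** (v6 with the param-form fcc leaf): `searchOK (entryLeafOK6RBKP muRec) … rootC rootW = true` and
`searchOK (entryLeafOKH3RDTK muRec) … rootCH rootWH = true` give `HomFloor (1/625)`. [folklore] -/
theorem homFloor_625_of_entrySearches6RBKP3RDTK
    {selF : ℕ → (Fin 3 × Fin 3 → ℤ) → (Fin 3 × Fin 3 → ℤ) → Fin 3 × Fin 3} {fuelF dF : ℕ}
    (hF : searchOK (entryLeafOK6RBKP muRec) selF fuelF dF rootC rootW = true)
    {selH : ℕ → ((Fin 3 × Fin 3) ⊕ Fin 3 → ℤ) → ((Fin 3 × Fin 3) ⊕ Fin 3 → ℤ) → (Fin 3 × Fin 3) ⊕ Fin 3} {fuelH dH : ℕ}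
    (hH : searchOK (entryLeafOKH3RDTK muRec) selH fuelH dH rootCH rootWH = true) : HomFloor (1 / 625) :=
  homFloor_of_entrySearches6RBKP3RDTK muRec_ok hF hH

/-- ★★★ **`(H) HomFloor (1/1000)`** — v7 at `μ = muMilli`. [folklore] -/
theorem homFloor_milli_of_entrySearches6RBKP3RDTK
    {selF : ℕ → (Fin 3 × Fin 3 → ℤ) → (Fin 3 × Fin 3 → ℤ) → Fin 3 × Fin 3} {fuelF dF : ℕ}
    (hF : searchOK (entryLeafOK6RBKP muMilli) selF fuelF dF rootC rootW = true)
    {selH : ℕ → ((Fin 3 × Fin 3) ⊕ Fin 3 → ℤ) → ((Fin 3 × Fin 3) ⊕ Fin 3 → ℤ) → (Fin 3 × Fin 3) ⊕ Fin 3} {fuelH dH : ℕ}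
    (hH : searchOK (entryLeafOKH3RDTK muMilli) selH fuelH dH rootCH rootWH = true) : HomFloor (1 / 1000) :=
  homFloor_of_entrySearches6RBKP3RDTK muMilli_ok hF hH

/-! ## §5. Kernel smoke test -/

/-- At the identity centre the PARAM-FORM table verdict accepts the entry box of half-width `2⁻⁸` (`2^40` at scale `SC`), which the tiered Gram-class
table verdict rejects; both evaluated in the kernel. -/
example : tableLeafOKP muRec rootC (fun _ => 1099511627776) = true ∧ tableLeafOKK muRec rootC (fun _ => 1099511627776) = false := by
  decide +kernel

end Summit.AtomisticToContinuum.Crystallization.Theorems.FrustratedLawDichotomyStrainedPatchHomEntryTableP
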